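import Mathlib
import HarnessLib
import Summits.PneNP.PneNP.Theses.RamseyUncertifiable
import Summits.PneNP.PneNP.Theorems.RamseyUncertifiableRamseyInCoNP
import Summits.PneNP.PneNP.Theorems.RamseyUncertifiableRamseyNotNPCliqueCount
import Summits.PneNP.PneNP.Theorems.RamseyUncertifiableRamseyNotNPUnionArith
import Summits.PneNP.PneNP.Theorems.RamseyNotNP.Negative.ComplementSymmetry
import Literature.Computability.Complexity.NondeterministicProofs
import Literature.Computability.Complexity.NPClosureProofs

/-!
# Dead-line certificate — line `Sketch` of the crux `RamseyNotNP` (stmt-PneNP-9814), lead -1, pass 2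

X = `Summit.PneNP.PneNP.Theses.RamseyUncertifiable.RamseyNotNP` (RAMSEY₂ ∉ NP at the Erdős threshold
`k(n) = Nat.clog 2 (n²) = ⌈2 log₂ n⌉`).  The line `Sketch` is built to its boundary: stubs A, B, C and the glue
are LANDED (p85860, p85736, p85754, p88147); the only open registered stub is D = `stub_typicalCliqueCapture`
(TCC).  This file is the kernel-checked content of the dead-line dossier `Lines/Sketch.dead.md`.  Everything is
sorry-free and uses only LANDED tree declarations.

* §1 `line_closure_proves_coNP_ne_NP` — META-FACT valid for EVERY line of this crux: whatever conjunction of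
  stubs `D` a skeleton composes into X (`D → RamseyNotNP` kernel-checked), a proof of `D` is a proof of
  `coNP ≠ NP` (and of `NP ≠ P`, and of the summit `PneNP`).  So no line for X can close short of a tree proof of
  `coNP ≠ NP`; "line-dead" here is a statement about STRENGTH, not about falsity of any stub.
* §2 the registered stub D verbatim (`TCC`) and its consequences: `TCC → X`, `TCC → coNP ≠ NP`,
  `TCC → CLIQUEFREE_thr ∉ NP`.
* §3 the deterministic shadow `TCCP` (replace NP by P in D): still `TCCP → CLIQUEFREE_thr ∉ P → PneNP` — weakening
  the certifier class does not bring D below summit strength (it becomes "no polynomial-time algorithm refutes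
  `ω(G) ≥ ⌈2log₂n⌉` for asymptotically all G", an average-case super-polynomial lower bound against all algorithms).
* §4 `TCC_iff_TCC₂` — the one-sided capture D is EQUIVALENT to the two-sided density statement
  TCC₂ = "no NP family of (codes of) 2-Ramsey graphs has density → 1" (intersect an almost-covering NP family of
  clique-free graphs with its complement-twin: `inter_mem_NP`, `preimage_mem_NP`, `exists_complFn`).  So the card's
  "one side only" is free bookkeeping at the apex: D is exactly the density-strengthening of X's instance form
  (`ramseyNotNPAt_iff_forall_NP_misses_infinite`: X ⟺ every NP family of Ramsey graphs misses infinitely many),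
  and nothing weaker than X is available inside the line.
-/

set_option linter.dupNamespace false

namespace Summit.PneNP.PneNP.Cruxes.RamseyNotNP.LineDead

open Finset
open Literature.Computability.Complexity
open Summit.PneNP.PneNP.Theses.RamseyUncertifiable (RamseyNotNP RamseyInCoNP closes)
open Summit.PneNP.PneNP.Theorems.RamseyNotNP

noncomputable section
open scoped Classical

/-! ## §0 Landed glue, re-derived (the farm snapshot serving this seat has not built
`Theorems/RamseyUncertifiableRamseyNotNPTypicalCapture.lean` (p88147) yet, so its two theorems used below —
`ramseyDense_filter` and `ramseyNotNP_of_typicalCliqueCapture` — are re-proved here VERBATIM from the registered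
skeleton `Lines/Sketch.lean`, fed with the landed stubs A (p85860) and B (p85736)). -/

namespace Glue

/-- Complement symmetry of the clique count (verbatim from the skeleton). -/
theorem card_filter_compl_isNClique (n k : ℕ) (S : Finset (Fin n)) :
    (univ.filter fun G : SimpleGraph (Fin n) => Gᶜ.IsNClique k S).card =
      (univ.filter fun G : SimpleGraph (Fin n) => G.IsNClique k S).card := by
  refine card_bij' (fun G _ => Gᶜ) (fun G _ => Gᶜ) ?_ ?_ ?_ ?_
  · intro G hG
    simp only [mem_filter, mem_univ, true_and] at hG ⊢
    exact hG
  · intro G hG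
    simp only [mem_filter, mem_univ, true_and] at hG ⊢
    simpa only [compl_compl] using hG
  · intro G _
    simp
  · intro G _
    simp

/-- Union bound (verbatim from the skeleton, Stub A = landed `stub_cliqueCount`). -/
theorem badCount_mul_le (n k : ℕ) :
    (univ.filter fun G : SimpleGraph (Fin n) => ¬ (G.CliqueFree k ∧ Gᶜ.CliqueFree k)).card * 2 ^ k.choose 2
      ≤ 2 * n.choose k * Fintype.card (SimpleGraph (Fin n)) := by
  have hA := TypicalCapture.stub_cliqueCount
  have hcover : (univ.filter fun G : SimpleGraph (Fin n) => ¬ (G.CliqueFree k ∧ Gᶜ.CliqueFree k)) ⊆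
      (univ.powersetCard k).biUnion fun S =>
        (univ.filter fun G : SimpleGraph (Fin n) => G.IsNClique k S) ∪
          (univ.filter fun G : SimpleGraph (Fin n) => Gᶜ.IsNClique k S) := by
    intro G hG
    rw [mem_filter] at hG
    rw [mem_biUnion]
    by_cases h1 : G.CliqueFree k
    · have h2 : ¬ Gᶜ.CliqueFree k := fun h2 => hG.2 ⟨h1, h2⟩
      simp only [SimpleGraph.CliqueFree, not_forall, not_not] at h2
      obtain ⟨S, hS⟩ := h2
      refine ⟨S, mem_powersetCard.mpr ⟨subset_univ _, hS.card_eq⟩, mem_union_right _ ?_⟩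
      simpa using hS
    · simp only [SimpleGraph.CliqueFree, not_forall, not_not] at h1
      obtain ⟨S, hS⟩ := h1
      refine ⟨S, mem_powersetCard.mpr ⟨subset_univ _, hS.card_eq⟩, mem_union_left _ ?_⟩
      simpa using hS
  calc (univ.filter fun G : SimpleGraph (Fin n) => ¬ (G.CliqueFree k ∧ Gᶜ.CliqueFree k)).card * 2 ^ k.choose 2
      ≤ (∑ S ∈ univ.powersetCard k,
          ((univ.filter fun G : SimpleGraph (Fin n) => G.IsNClique k S).card +
            (univ.filter fun G : SimpleGraph (Fin n) => Gᶜ.IsNClique k S).card)) * 2 ^ k.choose 2 := by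
        gcongr
        exact (card_le_card hcover).trans
          (card_biUnion_le.trans (sum_le_sum fun S _ => card_union_le _ _))
    _ = ∑ S ∈ univ.powersetCard k,
          2 * ((univ.filter fun G : SimpleGraph (Fin n) => G.IsNClique k S).card * 2 ^ k.choose 2) := by
        rw [sum_mul]
        refine sum_congr rfl fun S _ => ?_
        rw [card_filter_compl_isNClique]
        ring
    _ ≤ ∑ S ∈ univ.powersetCard k, 2 * Fintype.card (SimpleGraph (Fin n)) :=
        sum_le_sum fun S _ => Nat.mul_le_mul_left 2 (hA n k S)
    _ = 2 * n.choose k * Fintype.card (SimpleGraph (Fin n)) := by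
        rw [sum_const, card_powersetCard, card_univ, Fintype.card_fin, smul_eq_mul]
        ring

/-- RamseyDense, filter form (verbatim from the skeleton's `ramseyDense_of`, Stub B = landed `stub_unionArith`). -/
theorem ramseyDense_filter (c : ℝ) (hc : 0 < c) :
    ∃ n₀ : ℕ, ∀ n ≥ n₀, (1 - c) * (Fintype.card (SimpleGraph (Fin n)) : ℝ) <
      ((univ.filter fun G : SimpleGraph (Fin n) =>
        (⟨n, G⟩ : Σ m, SimpleGraph (Fin m)) ∈
          {p : Σ m, SimpleGraph (Fin m) | p.2.CliqueFree (Nat.clog 2 (p.1 ^ 2)) ∧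
            p.2ᶜ.CliqueFree (Nat.clog 2 (p.1 ^ 2))}).card : ℝ) := by
  obtain ⟨n₀, hn₀⟩ := TypicalCapture.stub_unionArith (⌈2 / c⌉₊ + 1)
  refine ⟨n₀, fun n hn => ?_⟩
  set k : ℕ := Nat.clog 2 (n ^ 2) with hk
  set T : ℕ := Fintype.card (SimpleGraph (Fin n)) with hT
  set M : ℕ := ⌈2 / c⌉₊ + 1 with hM
  have hB' : M * n.choose k < 2 ^ k.choose 2 := hn₀ n hn
  have hA' := badCount_mul_le n k
  have hsplit :
      (univ.filter fun G : SimpleGraph (Fin n) =>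
          (⟨n, G⟩ : Σ m, SimpleGraph (Fin m)) ∈
            {p : Σ m, SimpleGraph (Fin m) | p.2.CliqueFree (Nat.clog 2 (p.1 ^ 2)) ∧
              p.2ᶜ.CliqueFree (Nat.clog 2 (p.1 ^ 2))}).card +
        (univ.filter fun G : SimpleGraph (Fin n) => ¬ (G.CliqueFree k ∧ Gᶜ.CliqueFree k)).card = T := by
    have h1 : (univ.filter fun G : SimpleGraph (Fin n) =>
          (⟨n, G⟩ : Σ m, SimpleGraph (Fin m)) ∈
            {p : Σ m, SimpleGraph (Fin m) | p.2.CliqueFree (Nat.clog 2 (p.1 ^ 2)) ∧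
              p.2ᶜ.CliqueFree (Nat.clog 2 (p.1 ^ 2))}) =
        (univ.filter fun G : SimpleGraph (Fin n) => G.CliqueFree k ∧ Gᶜ.CliqueFree k) := by
      ext G
      simp only [mem_filter, mem_univ, true_and, Set.mem_setOf_eq, hk]
    rw [h1, hT, ← card_univ]
    exact card_filter_add_card_filter_not _
  have hTpos : (0 : ℝ) < T := by
    have : 0 < T := Fintype.card_pos
    exact_mod_cast this
  have hMc : 2 / c < (M : ℝ) := by
    have h := Nat.le_ceil (2 / c)
    rw [hM]
    push_cast
    linarith
  have hMpos : (0 : ℝ) < M := lt_trans (by positivity) hMc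
  have hcM : 2 < c * M := by
    have : c * (2 / c) = 2 := by field_simp
    nlinarith
  set b : ℕ := (univ.filter fun G : SimpleGraph (Fin n) => ¬ (G.CliqueFree k ∧ Gᶜ.CliqueFree k)).card
    with hb
  have hPpos : (0 : ℝ) < (2 : ℝ) ^ k.choose 2 := by positivity
  have hA'' : (b : ℝ) * (2 : ℝ) ^ k.choose 2 ≤ 2 * (n.choose k : ℝ) * T := by exact_mod_cast hA'
  have hB'' : (M : ℝ) * (n.choose k : ℝ) < (2 : ℝ) ^ k.choose 2 := by exact_mod_cast hB'
  have h1 : (b : ℝ) * (2 : ℝ) ^ k.choose 2 * M < 2 * T * (2 : ℝ) ^ k.choose 2 := by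
    calc (b : ℝ) * (2 : ℝ) ^ k.choose 2 * M ≤ 2 * (n.choose k : ℝ) * T * M := by
          exact mul_le_mul_of_nonneg_right hA'' hMpos.le
      _ = 2 * T * ((M : ℝ) * (n.choose k : ℝ)) := by ring
      _ < 2 * T * (2 : ℝ) ^ k.choose 2 := by
          exact mul_lt_mul_of_pos_left hB'' (by positivity)
  have h2 : (b : ℝ) * M < 2 * T := by
    have h1' : ((b : ℝ) * M) * (2 : ℝ) ^ k.choose 2 < (2 * T) * (2 : ℝ) ^ k.choose 2 := by
      calc ((b : ℝ) * M) * (2 : ℝ) ^ k.choose 2 = (b : ℝ) * (2 : ℝ) ^ k.choose 2 * M := by ring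
        _ < 2 * T * (2 : ℝ) ^ k.choose 2 := h1
    exact lt_of_mul_lt_mul_right h1' hPpos.le
  have h3 : (b : ℝ) < c * T := by
    have h' : (b : ℝ) * M < (c * T) * M := by
      calc (b : ℝ) * M < 2 * T := h2
        _ < (c * M) * T := by exact mul_lt_mul_of_pos_right hcM hTpos
        _ = (c * T) * M := by ring
    exact lt_of_mul_lt_mul_right h' hMpos.le
  have hgood : ((univ.filter fun G : SimpleGraph (Fin n) =>
          (⟨n, G⟩ : Σ m, SimpleGraph (Fin m)) ∈
            {p : Σ m, SimpleGraph (Fin m) | p.2.CliqueFree (Nat.clog 2 (p.1 ^ 2)) ∧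
              p.2ᶜ.CliqueFree (Nat.clog 2 (p.1 ^ 2))}).card : ℝ) = T - b := by
    have h := congrArg (fun x : ℕ => (x : ℝ)) hsplit
    push_cast at h
    linarith
  rw [hgood]
  linarith

/-- **TCC ⇒ X** (verbatim from the landed `ramseyNotNP_of_typicalCliqueCapture`, p88147). -/
theorem ramseyNotNP_of_typicalCliqueCapture
    (hD : ∀ S : Set (Σ n, SimpleGraph (Fin n)),
      encodingGraph.toLanguage S ∈ Nondeterministic.NP →
      S ⊆ {p | p.2.CliqueFree (Nat.clog 2 (p.1 ^ 2))} →
      ∃ c : ℝ, 0 < c ∧ ∀ n₀ : ℕ, ∃ n ≥ n₀,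
        ((univ.filter fun G : SimpleGraph (Fin n) => (⟨n, G⟩ : Σ m, SimpleGraph (Fin m)) ∈ S).card : ℝ) ≤
          (1 - c) * Fintype.card (SimpleGraph (Fin n))) :
    RamseyNotNP := by
  unfold Summit.PneNP.PneNP.Theses.RamseyUncertifiable.RamseyNotNP
  intro hNP
  obtain ⟨c, hc, hio⟩ := hD _ hNP (fun p hp => hp.1)
  obtain ⟨n₀, hn₀⟩ := ramseyDense_filter c hc
  obtain ⟨n, hn, hle⟩ := hio n₀
  have hle' : ((univ.filter fun G : SimpleGraph (Fin n) =>
        (⟨n, G⟩ : Σ m, SimpleGraph (Fin m)) ∈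
          {p : Σ m, SimpleGraph (Fin m) | p.2.CliqueFree (Nat.clog 2 (p.1 ^ 2)) ∧
            p.2ᶜ.CliqueFree (Nat.clog 2 (p.1 ^ 2))}).card : ℝ) ≤
      (1 - c) * Fintype.card (SimpleGraph (Fin n)) := by
    convert hle using 4
  exact absurd (hn₀ n hn) (not_lt.mpr hle')

end Glue

/-! ## §1 Every line for X is a proof of `coNP ≠ NP` -/

/-- **Meta-fact (all lines).** If a skeleton composes stubs `D` into the crux, then the stubs prove `coNP ≠ NP`. -/
theorem line_closure_proves_coNP_ne_NP {D : Prop} (hline : D → RamseyNotNP) (hD : D) :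
    coNP ≠ Nondeterministic.NP :=
  Negative.coNP_ne_NP_of_ramseyNotNP (hline hD)

/-- … and `NP ≠ P`. -/
theorem line_closure_proves_NP_ne_P {D : Prop} (hline : D → RamseyNotNP) (hD : D) :
    Nondeterministic.NP ≠ Classes.P :=
  Negative.NP_ne_P_of_ramseyNotNP (hline hD)

/-- … and the summit `PneNP` (through the route's own deciding theorem `closes` and the landed support
`ramseyInCoNP_proof`). -/
theorem line_closure_proves_pneNP {D : Prop} (hline : D → RamseyNotNP) (hD : D) : PneNP :=
  closes (hline hD) Summit.PneNP.PneNP.Theorems.ramseyInCoNP_proof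

/-! ## §2 The registered stub D = TCC, verbatim, and its strength -/

/-- The registered stub `stub_typicalCliqueCapture` of line `Sketch`, verbatim (TCC: every `NP` language of graph
codes all of whose members are `⌈2log₂n⌉`-clique-free misses a constant fraction of all graphs on `Fin n` for
infinitely many `n`). -/
def TCC : Prop :=
  ∀ S : Set (Σ n, SimpleGraph (Fin n)),
    encodingGraph.toLanguage S ∈ Nondeterministic.NP →
    S ⊆ {p | p.2.CliqueFree (Nat.clog 2 (p.1 ^ 2))} →
    ∃ c : ℝ, 0 < c ∧ ∀ n₀ : ℕ, ∃ n ≥ n₀,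
      ((univ.filter fun G : SimpleGraph (Fin n) => (⟨n, G⟩ : Σ m, SimpleGraph (Fin m)) ∈ S).card : ℝ) ≤
        (1 - c) * Fintype.card (SimpleGraph (Fin n))

/-- D closes the line (landed glue `ramseyNotNP_of_typicalCliqueCapture`, p88147; §0 copy). -/
theorem ramseyNotNP_of_TCC (h : TCC) : RamseyNotNP :=
  Glue.ramseyNotNP_of_typicalCliqueCapture h

/-- Hence D proves `coNP ≠ NP`. -/
theorem coNP_ne_NP_of_TCC (h : TCC) : coNP ≠ Nondeterministic.NP :=
  line_closure_proves_coNP_ne_NP ramseyNotNP_of_TCC h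

/-- Hence D proves the summit. -/
theorem pneNP_of_TCC (h : TCC) : PneNP :=
  line_closure_proves_pneNP ramseyNotNP_of_TCC h

/-- D forces the one-sided language out of `NP` as well (`CLIQUEFREE_{⌈2log₂n⌉} ∉ NP`, via X and the landed
complement symmetry). -/
theorem cliqueFree_not_mem_NP_of_TCC (h : TCC) :
    Negative.cliqueFreeLangAt Negative.thr ∉ Nondeterministic.NP :=
  Negative.cliqueFree_not_mem_NP_of_ramseyNotNPAt (k := Negative.thr) (ramseyNotNP_of_TCC h)

/-! ## §3 The deterministic shadow of D is still summit-strength -/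

/-- `TCCP`: D with `NP` weakened to `P` — no POLYNOMIAL-TIME decidable property of graph codes that implies
`ω(G) < ⌈2log₂n⌉` holds for asymptotically all graphs (deterministic planted-clique refutation at the Erdős
threshold is impossible). -/
def TCCP : Prop :=
  ∀ S : Set (Σ n, SimpleGraph (Fin n)),
    encodingGraph.toLanguage S ∈ Classes.P →
    S ⊆ {p | p.2.CliqueFree (Nat.clog 2 (p.1 ^ 2))} →
    ∃ c : ℝ, 0 < c ∧ ∀ n₀ : ℕ, ∃ n ≥ n₀,
      ((univ.filter fun G : SimpleGraph (Fin n) => (⟨n, G⟩ : Σ m, SimpleGraph (Fin m)) ∈ S).card : ℝ) ≤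
        (1 - c) * Fintype.card (SimpleGraph (Fin n))

/-- `TCC → TCCP` (`P ⊆ NP`). -/
theorem TCCP_of_TCC (h : TCC) : TCCP :=
  fun S hS hsub => h S (P_subset_NP_holds hS) hsub

/-- **The shadow already forces `CLIQUEFREE_thr ∉ P`**: the whole clique-free set is a `P` language (if
`CLIQUEFREE_thr ∈ P`) of clique-free codes containing RAMSEY₂, hence of density → 1 (`ramseyDense_filter`),
contradicting `TCCP`. -/
theorem cliqueFree_not_mem_P_of_TCCP (h : TCCP) : Negative.cliqueFreeLangAt Negative.thr ∉ Classes.P := by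
  intro hP
  obtain ⟨c, hc, hio⟩ := h {p | p.2.CliqueFree (Nat.clog 2 (p.1 ^ 2))} hP subset_rfl
  obtain ⟨n₀, hn₀⟩ := Glue.ramseyDense_filter c hc
  obtain ⟨n, hn, hle⟩ := hio n₀
  have hdense := hn₀ n hn
  have hmono :
      (univ.filter fun G : SimpleGraph (Fin n) =>
          (⟨n, G⟩ : Σ m, SimpleGraph (Fin m)) ∈
            {p : Σ m, SimpleGraph (Fin m) | p.2.CliqueFree (Nat.clog 2 (p.1 ^ 2)) ∧
              p.2ᶜ.CliqueFree (Nat.clog 2 (p.1 ^ 2))}).card ≤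
        (univ.filter fun G : SimpleGraph (Fin n) =>
          (⟨n, G⟩ : Σ m, SimpleGraph (Fin m)) ∈
            {p : Σ m, SimpleGraph (Fin m) | p.2.CliqueFree (Nat.clog 2 (p.1 ^ 2))}).card := by
    refine card_le_card fun G hG => ?_
    simp only [mem_filter, mem_univ, true_and, Set.mem_setOf_eq] at hG ⊢
    exact hG.1
  have hmono' :
      ((univ.filter fun G : SimpleGraph (Fin n) =>
          (⟨n, G⟩ : Σ m, SimpleGraph (Fin m)) ∈
            {p : Σ m, SimpleGraph (Fin m) | p.2.CliqueFree (Nat.clog 2 (p.1 ^ 2)) ∧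
              p.2ᶜ.CliqueFree (Nat.clog 2 (p.1 ^ 2))}).card : ℝ) ≤
        ((univ.filter fun G : SimpleGraph (Fin n) =>
          (⟨n, G⟩ : Σ m, SimpleGraph (Fin m)) ∈
            {p : Σ m, SimpleGraph (Fin m) | p.2.CliqueFree (Nat.clog 2 (p.1 ^ 2))}).card : ℝ) := by
    exact_mod_cast hmono
  -- `hle` carries the `DecidablePred` instance of `TCCP`'s body; `convert` identifies it with ours
  have hle' :
      ((univ.filter fun G : SimpleGraph (Fin n) =>
          (⟨n, G⟩ : Σ m, SimpleGraph (Fin m)) ∈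
            {p : Σ m, SimpleGraph (Fin m) | p.2.CliqueFree (Nat.clog 2 (p.1 ^ 2))}).card : ℝ) ≤
        (1 - c) * Fintype.card (SimpleGraph (Fin n)) := by
    convert hle using 4
  linarith

/-- **Even the shadow proves the summit**: `TCCP → PneNP` (if `¬PneNP` then `CLIQUEFREE_thr ∈ P`, landed
`cliqueFreeLang_thr_mem_P_of_not_pneNP`). -/
theorem pneNP_of_TCCP (h : TCCP) : PneNP := by
  by_contra hne
  exact cliqueFree_not_mem_P_of_TCCP h (Negative.cliqueFreeLang_thr_mem_P_of_not_pneNP hne)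

/-! ## §4 One-sided capture = two-sided density capture -/

/-- `TCC₂`: no `NP` family of (codes of) 2-Ramsey graphs at the Erdős threshold has density → 1 — the
density-strengthening of X's instance form. -/
def TCC₂ : Prop :=
  ∀ S : Set (Σ n, SimpleGraph (Fin n)),
    encodingGraph.toLanguage S ∈ Nondeterministic.NP →
    S ⊆ {p | p.2.CliqueFree (Nat.clog 2 (p.1 ^ 2)) ∧ p.2ᶜ.CliqueFree (Nat.clog 2 (p.1 ^ 2))} →
    ∃ c : ℝ, 0 < c ∧ ∀ n₀ : ℕ, ∃ n ≥ n₀,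
      ((univ.filter fun G : SimpleGraph (Fin n) => (⟨n, G⟩ : Σ m, SimpleGraph (Fin m)) ∈ S).card : ℝ) ≤
        (1 - c) * Fintype.card (SimpleGraph (Fin n))

/-- `TCC → TCC₂` (a family of Ramsey graphs is a family of clique-free graphs). -/
theorem TCC₂_of_TCC (h : TCC) : TCC₂ :=
  fun S hS hsub => h S hS fun _ hp => (hsub hp).1

/-- The complement-twin count: `#{G | ⟨n, Gᶜ⟩ ∈ S} = #{G | ⟨n, G⟩ ∈ S}` (`G ↦ Gᶜ` is an involution of the
graphs on `Fin n`). -/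
theorem card_filter_compl_mem (S : Set (Σ n, SimpleGraph (Fin n))) (n : ℕ) :
    (univ.filter fun G : SimpleGraph (Fin n) => (⟨n, Gᶜ⟩ : Σ m, SimpleGraph (Fin m)) ∈ S).card =
      (univ.filter fun G : SimpleGraph (Fin n) => (⟨n, G⟩ : Σ m, SimpleGraph (Fin m)) ∈ S).card := by
  refine card_bij' (fun G _ => Gᶜ) (fun G _ => Gᶜ) ?_ ?_ ?_ ?_
  · intro G hG
    simp only [mem_filter, mem_univ, true_and] at hG ⊢
    exact hG
  · intro G hG
    simp only [mem_filter, mem_univ, true_and] at hG ⊢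
    simpa only [compl_compl] using hG
  · intro G _
    simp
  · intro G _
    simp

/-- **`TCC₂ → TCC`.** Given an `NP` family `S` of clique-free codes, its complement-symmetric core
`S' = {G ∈ S | Gᶜ ∈ S}` is an `NP` family (`inter_mem_NP`, `preimage_mem_NP` along the `FP` complement map
`exists_complFn`, injectivity of the code) of 2-Ramsey graphs with `#S'ₙ ≥ 2·#Sₙ − #all`; so if `S'` misses a
`c`-fraction infinitely often, `S` misses a `c/2`-fraction infinitely often. -/
theorem TCC_of_TCC₂ (h2 : TCC₂) : TCC := by
  intro S hS hsub
  obtain ⟨f, hf, hfspec⟩ := Negative.exists_complFn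
  -- the complement-symmetric core of `S`
  set S' : Set (Σ n, SimpleGraph (Fin n)) :=
    {p | p ∈ S ∧ (⟨p.1, p.2ᶜ⟩ : Σ n, SimpleGraph (Fin n)) ∈ S} with hS'def
  have hS'NP : encodingGraph.toLanguage S' ∈ Nondeterministic.NP := by
    have hcap := Negative.inter_mem_NP hS (preimage_mem_NP hS hf)
    convert hcap using 1
    ext x
    change x ∈ encodingGraph.encode '' S' ↔ x ∈ encodingGraph.encode '' S ∩ f ⁻¹' (encodingGraph.encode '' S)
    constructor
    · rintro ⟨p, ⟨hp₁, hp₂⟩, rfl⟩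
      refine ⟨⟨p, hp₁, rfl⟩, ?_⟩
      obtain ⟨n, G⟩ := p
      show f (encodingGraph.encode ⟨n, G⟩) ∈ encodingGraph.encode '' S
      rw [hfspec n G]
      exact ⟨_, hp₂, rfl⟩
    · rintro ⟨⟨p, hp, rfl⟩, hq⟩
      obtain ⟨n, G⟩ := p
      have hq' : encodingGraph.encode (⟨n, Gᶜ⟩ : Σ m, SimpleGraph (Fin m)) ∈ encodingGraph.encode '' S := by
        have : f (encodingGraph.encode ⟨n, G⟩) ∈ encodingGraph.encode '' S := hq
        rwa [hfspec n G] at this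
      obtain ⟨q, hqS, hqe⟩ := hq'
      have hq'' : q = ⟨n, Gᶜ⟩ := encodingGraph.encode_injective hqe
      subst hq''
      exact ⟨⟨n, G⟩, ⟨hp, hqS⟩, rfl⟩
  have hS'sub : S' ⊆ {p | p.2.CliqueFree (Nat.clog 2 (p.1 ^ 2)) ∧ p.2ᶜ.CliqueFree (Nat.clog 2 (p.1 ^ 2))} :=
    fun _ hp => ⟨hsub hp.1, hsub hp.2⟩
  obtain ⟨c, hc, hio⟩ := h2 S' hS'NP hS'sub
  refine ⟨c / 2, by positivity, fun n₀ => ?_⟩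
  obtain ⟨n, hn, hle⟩ := hio n₀
  refine ⟨n, hn, ?_⟩
  -- counting on `Fin n`: A = members of S, B = complement-twins of members, A ∩ B = members of S'
  set A : Finset (SimpleGraph (Fin n)) :=
    univ.filter fun G : SimpleGraph (Fin n) => (⟨n, G⟩ : Σ m, SimpleGraph (Fin m)) ∈ S with hA
  set B : Finset (SimpleGraph (Fin n)) :=
    univ.filter fun G : SimpleGraph (Fin n) => (⟨n, Gᶜ⟩ : Σ m, SimpleGraph (Fin m)) ∈ S with hB
  set T : ℕ := Fintype.card (SimpleGraph (Fin n)) with hT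
  have hAB : (univ.filter fun G : SimpleGraph (Fin n) => (⟨n, G⟩ : Σ m, SimpleGraph (Fin m)) ∈ S') = A ∩ B := by
    ext G
    simp only [hA, hB, hS'def, mem_filter, mem_univ, true_and, mem_inter, Set.mem_setOf_eq]
  have hBA : B.card = A.card := card_filter_compl_mem S n
  have hunion : (A ∪ B).card ≤ T := by
    rw [hT, ← card_univ]
    exact card_le_card (subset_univ _)
  have hident : (A ∪ B).card + (A ∩ B).card = A.card + B.card := card_union_add_card_inter A B
  have hle' : ((A ∩ B).card : ℝ) ≤ (1 - c) * T := by
    rw [← hAB]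
    -- (`hle` carries the `DecidablePred` instance of `TCC₂`'s body; `convert` identifies it with ours)
    convert hle using 4
  -- 2·|A| = |A ∪ B| + |A ∩ B| ≤ T + (1 - c)·T
  have h2A : (2 : ℝ) * A.card ≤ T + (1 - c) * T := by
    have h1 : ((A ∪ B).card : ℝ) + (A ∩ B).card = A.card + B.card := by exact_mod_cast hident
    have h2 : ((A ∪ B).card : ℝ) ≤ T := by exact_mod_cast hunion
    have h3 : (B.card : ℝ) = A.card := by exact_mod_cast hBA
    linarith
  show (A.card : ℝ) ≤ (1 - c / 2) * T
  linarith

/-- **D is exactly the two-sided density capture**: `TCC ↔ TCC₂`. -/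
theorem TCC_iff_TCC₂ : TCC ↔ TCC₂ :=
  ⟨TCC₂_of_TCC, TCC_of_TCC₂⟩

end

end Summit.PneNP.PneNP.Cruxes.RamseyNotNP.LineDead
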